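import Literature.AlgebraicTopology.Homotopy.CompactlySupportedSpheres
import Mathlib.Analysis.Convex.Topology
import HarnessLib

/-!
# Gluing maps along a finite closed cover, and shrinking the pieces of a sphere

Topic `Literature/AlgebraicTopology/Homotopy`, continuing `CompactlySupportedSpheres.lean`.
Two elementary tools for cutting and pasting compactly supported spheres `φ : ℝᵏ → X`:

* `glueFun`, `continuous_glueFun`: given finitely many continuous maps `Ψᵢ : P → Y` and closed
  sets `Cᵢ ⊆ P` such that `Ψᵢ = y₀` off the interior of `Cᵢ` and `Ψᵢ = Ψⱼ` on `Cᵢ ∩ Cⱼ`, the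
  map equal to `Ψᵢ` on `Cᵢ` and to `y₀` elsewhere is continuous (pasting lemma on the closed
  cover `{Cᵢ} ∪ {closure (⋃ Cᵢ)ᶜ}`);
* `CSphere.glue`: the corresponding compactly supported sphere;
* `CSphere.homothety`, `CSphere.toClass_homothety`: precomposition with the inverse of the
  homothety `y ↦ p + t (y - p)` (`t > 0`) does not change the class;
* `CSphere.shrunkSet`, `CSphere.shrinkAt`, `CSphere.homotopic_shrinkAt`: given spheres `ψᵢ`
  supported in closed convex sets `Zᵢ` with pairwise disjoint interiors, each `ψᵢ` vanishing off
  the interior of `Zᵢ`, and interior points `pᵢ ∈ Zᵢ`, the sphere `shrinkAt … t` gluing the `ψᵢ`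
  shrunk by the factor `t ∈ (0, 1]` about `pᵢ` (supports `shrunkSet Z p i t`) moves by a homotopy
  of compactly supported spheres as `t` varies; at `t = 1` it is the superposition of the `ψᵢ`
  (`shrinkAt_one_apply`; the pieces agree on overlaps, `agree_of_disjoint_interior`), for
  `t < 1` the shrunk pieces have pairwise disjoint supports.

Everything is proved; `[folklore]`.

## References

* A. Hatcher, *Algebraic Topology*, CUP (2002), §4.1, p. 340 (cutting and pasting
  representatives of `πₙ`). [HatcherAT2002]
-/

noncomputable section

open Set Metric unitInterval Topology
open scoped Topology.Homotopy

universe u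

namespace Literature.AlgebraicTopology.Homotopy

/-! ### The pasting lemma for a finite closed cover plus background value -/

section Glue

variable {P : Type*} {Y : Type*} {ι : Type*}

/-- The glued map: `Ψᵢ` on `Cᵢ`, the background value `y₀` elsewhere. [folklore] -/
def glueFun (y₀ : Y) (Ψ : ι → P → Y) (C : ι → Set P) (p : P) : Y := by
  classical exact if h : ∃ i, p ∈ C i then Ψ h.choose p else y₀

/-- On `Cᵢ` the glued map is `Ψᵢ` (the maps agree on overlaps). [folklore] -/
theorem glueFun_eq_of_mem {y₀ : Y} {Ψ : ι → P → Y} {C : ι → Set P}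
    (hagree : ∀ i j p, p ∈ C i → p ∈ C j → Ψ i p = Ψ j p) {i : ι} {p : P} (hp : p ∈ C i) :
    glueFun y₀ Ψ C p = Ψ i p := by
  classical
  have h : ∃ i, p ∈ C i := ⟨i, hp⟩
  unfold glueFun
  rw [dif_pos h]
  exact hagree _ _ _ h.choose_spec hp

/-- Off all `Cᵢ` the glued map is the background value. [folklore] -/
theorem glueFun_eq_of_forall_not_mem {y₀ : Y} {Ψ : ι → P → Y} {C : ι → Set P} {p : P}
    (hp : ∀ i, p ∉ C i) : glueFun y₀ Ψ C p = y₀ := by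
  classical
  unfold glueFun
  rw [dif_neg (fun ⟨i, hi⟩ => hp i hi)]

variable [TopologicalSpace P]

/-- Off the interiors of all `Cᵢ` the glued map is the background value (each `Ψᵢ` is `y₀` off
the interior of `Cᵢ`). [folklore] -/
theorem glueFun_eq_of_forall_not_mem_interior {y₀ : Y} {Ψ : ι → P → Y} {C : ι → Set P}
    (hagree : ∀ i j p, p ∈ C i → p ∈ C j → Ψ i p = Ψ j p)
    (hoff : ∀ i p, p ∉ interior (C i) → Ψ i p = y₀) {p : P} (hp : ∀ i, p ∉ interior (C i)) :
    glueFun y₀ Ψ C p = y₀ := by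
  by_cases h : ∃ i, p ∈ C i
  · obtain ⟨i, hi⟩ := h
    rw [glueFun_eq_of_mem hagree hi]
    exact hoff i p (hp i)
  · exact glueFun_eq_of_forall_not_mem fun i hi => h ⟨i, hi⟩

variable [TopologicalSpace Y]

/-- **Pasting lemma with background.** Finitely many continuous maps `Ψᵢ`, closed sets `Cᵢ`,
`Ψᵢ = y₀` off the interior of `Cᵢ`, `Ψᵢ = Ψⱼ` on `Cᵢ ∩ Cⱼ`: the glued map is continuous.
[folklore] -/
theorem continuous_glueFun [Finite ι] {y₀ : Y} {Ψ : ι → P → Y} (hΨ : ∀ i, Continuous (Ψ i))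
    {C : ι → Set P} (hC : ∀ i, IsClosed (C i))
    (hagree : ∀ i j p, p ∈ C i → p ∈ C j → Ψ i p = Ψ j p)
    (hoff : ∀ i p, p ∉ interior (C i) → Ψ i p = y₀) : Continuous (glueFun y₀ Ψ C) := by
  -- the closed cover `{Cᵢ} ∪ {closure (⋃ Cᵢ)ᶜ}`
  set D : Set P := closure (⋃ i, C i)ᶜ with hD
  let F : Option ι → Set P := fun o => o.elim D C
  have hFc : ∀ o, IsClosed (F o) := fun o => by cases o; exacts [isClosed_closure, hC _]
  have hcover : univ ⊆ ⋃ o, F o := fun p _ => by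
    by_cases h : p ∈ ⋃ i, C i
    · obtain ⟨i, hi⟩ := mem_iUnion.1 h
      exact mem_iUnion.2 ⟨some i, hi⟩
    · exact mem_iUnion.2 ⟨none, subset_closure h⟩
  have hcont : ∀ o, ContinuousOn (glueFun y₀ Ψ C) (F o) := by
    rintro (_ | i)
    · -- on `D` the glued map is constant `= y₀`
      refine continuousOn_const.congr fun p hp => glueFun_eq_of_forall_not_mem_interior hagree hoff
        fun i hi => ?_
      -- `interior Cᵢ` is an open neighbourhood of `p` missing `(⋃ Cᵢ)ᶜ`
      have h1 : interior (C i) ∩ (⋃ i, C i)ᶜ = ∅ := by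
        ext q; simp only [mem_inter_iff, mem_compl_iff, mem_iUnion, not_exists, mem_empty_iff_false,
          iff_false, not_and, not_forall, not_not]
        exact fun hq => ⟨i, interior_subset hq⟩
      have h2 := (mem_closure_iff.1 hp) (interior (C i)) isOpen_interior hi
      rw [h1] at h2
      exact h2.ne_empty rfl
    · exact (hΨ i).continuousOn.congr fun p hp => glueFun_eq_of_mem hagree hp
  rw [← continuousOn_univ]
  exact ((locallyFinite_of_finite F).continuousOn_iUnion hFc hcont).mono hcover

end Glue

namespace CSphere

variable {k : ℕ} {X : Type u} [TopologicalSpace X] {x₀ : X}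

/-! ### Gluing compactly supported spheres -/

/-- **The glued sphere** of finitely many compactly supported spheres `ψᵢ` with closed
"supports" `Kᵢ` (`ψᵢ = x₀` off the interior of `Kᵢ`) agreeing on overlaps. [folklore] -/
def glue {ι : Type*} [Finite ι] (ψ : ι → CSphere k X x₀) (K : ι → Set (Fin k → ℝ))
    (hK : ∀ i, IsClosed (K i)) (hagree : ∀ i j y, y ∈ K i → y ∈ K j → ψ i y = ψ j y)
    (hoff : ∀ i y, y ∉ interior (K i) → ψ i y = x₀) : CSphere k X x₀ :=
  ⟨glueFun x₀ (fun i => ψ i) K, continuous_glueFun (fun i => (ψ i).continuous) hK hagree hoff, by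
    choose R hR using fun i => (ψ i).exists_bound
    obtain ⟨R₀, hR₀⟩ := (Set.finite_range R).bddAbove
    refine ⟨R₀, fun y hy => ?_⟩
    by_cases h : ∃ i, y ∈ K i
    · obtain ⟨i, hi⟩ := h
      rw [glueFun_eq_of_mem hagree hi]
      exact hR i y ((hR₀ ⟨i, rfl⟩).trans hy)
    · exact glueFun_eq_of_forall_not_mem fun i hi => h ⟨i, hi⟩⟩

/-- On `Kᵢ` the glued sphere is `ψᵢ`. [folklore] -/
theorem glue_apply_of_mem {ι : Type*} [Finite ι] {ψ : ι → CSphere k X x₀} {K : ι → Set (Fin k → ℝ)}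
    {hK hagree hoff} {i : ι} {y : Fin k → ℝ} (hy : y ∈ K i) :
    glue ψ K hK hagree hoff y = ψ i y :=
  glueFun_eq_of_mem hagree hy

/-- Off all `Kᵢ` the glued sphere is `x₀`. [folklore] -/
theorem glue_apply_of_forall_not_mem {ι : Type*} [Finite ι] {ψ : ι → CSphere k X x₀}
    {K : ι → Set (Fin k → ℝ)} {hK hagree hoff} {y : Fin k → ℝ} (hy : ∀ i, y ∉ K i) :
    glue ψ K hK hagree hoff y = x₀ :=
  glueFun_eq_of_forall_not_mem (Ψ := fun i => ⇑(ψ i)) hy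

/-! ### Homotheties -/

/-- The inverse homothety moves far points far: `r⁻¹ ‖y - p‖ - ‖p‖ ≤ ‖p + r⁻¹ (y - p)‖`.
[folklore] -/
theorem le_norm_homothetyInv (p y : Fin k → ℝ) {r : ℝ} (hr : 0 < r) :
    r⁻¹ * ‖y - p‖ - ‖p‖ ≤ ‖p + r⁻¹ • (y - p)‖ := by
  have h := norm_sub_norm_le (r⁻¹ • (y - p)) (-p)
  rw [sub_neg_eq_add, add_comm, norm_neg, norm_smul, norm_inv, Real.norm_eq_abs, abs_of_pos hr] at h
  exact h

/-- If `‖y‖ ≥ M (R + ‖p‖) + ‖p‖` and `0 < r ≤ M`, then `‖p + r⁻¹ (y - p)‖ ≥ R`. [folklore] -/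
theorem le_norm_homothetyInv_of_le {p y : Fin k → ℝ} {r M R : ℝ} (hr : 0 < r) (hrM : r ≤ M)
    (hR : 0 ≤ R) (hy : M * (R + ‖p‖) + ‖p‖ ≤ ‖y‖) : R ≤ ‖p + r⁻¹ • (y - p)‖ := by
  have h1 : ‖y‖ - ‖p‖ ≤ ‖y - p‖ := norm_sub_norm_le y p
  have h2 : r * (R + ‖p‖) ≤ ‖y - p‖ := by nlinarith [norm_nonneg p]
  have h3 : R + ‖p‖ ≤ r⁻¹ * ‖y - p‖ := by
    rw [← div_eq_inv_mul, le_div_iff₀ hr]; linarith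
  linarith [le_norm_homothetyInv p y hr]

/-- Precomposition with the inverse `y ↦ p + t⁻¹ (y - p)` of the homothety of ratio `t > 0`
centred at `p`: the sphere `φ` "shrunk by the factor `t` about `p`". [folklore] -/
def homothety (φ : CSphere k X x₀) (p : Fin k → ℝ) (t : ℝ) (ht : 0 < t) : CSphere k X x₀ :=
  ⟨fun y => φ (p + t⁻¹ • (y - p)), by fun_prop, by
    obtain ⟨R, hR0, hR⟩ := φ.exists_bound_nonneg
    exact ⟨t * (R + ‖p‖) + ‖p‖, fun y hy => hR _ (le_norm_homothetyInv_of_le ht le_rfl hR0 hy)⟩⟩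

/-- Unfolding `homothety`. [folklore] -/
@[simp] theorem homothety_apply (φ : CSphere k X x₀) (p : Fin k → ℝ) (t : ℝ) (ht : 0 < t)
    (y : Fin k → ℝ) : homothety φ p t ht y = φ (p + t⁻¹ • (y - p)) := rfl

/-- **Shrinking does not change the class**: the ratio is joined to `1`. [folklore] -/
theorem toClass_homothety (φ : CSphere k X x₀) (p : Fin k → ℝ) (t : ℝ) (ht : 0 < t) :
    (homothety φ p t ht).toClass = φ.toClass := by
  -- ratios `r s = (1 - s) + s t` along the segment from `1` to `t`, all in `[min t 1, max t 1]`
  have hrat : ∀ s ∈ Icc (0 : ℝ) 1, min t 1 ≤ (1 - s) + s * t ∧ (1 - s) + s * t ≤ max t 1 := by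
    intro s hs
    have := min_le_left t 1; have := min_le_right t 1
    have := le_max_left t 1; have := le_max_right t 1
    constructor <;> nlinarith [hs.1, hs.2]
  have hm0 : 0 < min t 1 := lt_min ht one_pos
  set r : ℝ → ℝ := fun s => (1 - ((projIcc 0 1 zero_le_one s : I) : ℝ)) + (projIcc 0 1 zero_le_one s : ℝ) * t
    with hrdef
  have hr0 : ∀ s, 0 < r s := fun s => hm0.trans_le (hrat _ (projIcc 0 1 zero_le_one s).2).1
  let Φ : ℝ → CSphere k X x₀ := fun s => homothety φ p (r s) (hr0 s)
  have hΦ0 : Φ 0 = φ := ext fun y => by simp [Φ, hrdef]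
  have hΦ1 : Φ 1 = homothety φ p t ht := ext fun y => by simp [Φ, hrdef]
  rw [← hΦ1]
  conv_rhs => rw [← hΦ0]
  obtain ⟨R, hR0, hR⟩ := φ.exists_bound_nonneg
  refine Eq.symm (homotopic_of_family Φ ?_ (max t 1 * (R + ‖p‖) + ‖p‖) fun s _ y hy => hR _ ?_).toClass_eq
  · have hc : Continuous r := by rw [hrdef]; fun_prop
    show Continuous fun q : (Fin k → ℝ) × ℝ => φ (p + (r q.2)⁻¹ • (q.1 - p))
    exact φ.continuous.comp (continuous_const.add
      (((hc.comp continuous_snd).inv₀ fun q => (hr0 q.2).ne').smul (continuous_fst.sub continuous_const)))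
  · exact le_norm_homothetyInv_of_le (hr0 s) (hrat _ (projIcc 0 1 zero_le_one s).2).2 hR0 hy

/-! ### Shrinking the pieces of a glued sphere -/

section Shrink

variable {ι : Type*} [Finite ι] (ψ : ι → CSphere k X x₀) (Z : ι → Set (Fin k → ℝ))
  (p : ι → Fin k → ℝ)

/-- The support of the piece `i` shrunk by the factor `t` about `pᵢ`: the preimage of `Zᵢ` under
the inverse homothety (meaningful for `t > 0` only; for `t = 0`, where `t⁻¹ = 0`, it is the junk
value `univ` or `∅` according as `pᵢ ∈ Zᵢ` or not). [folklore] -/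
def shrunkSet (i : ι) (t : ℝ) : Set (Fin k → ℝ) := {y | p i + t⁻¹ • (y - p i) ∈ Z i}

variable {ψ Z p}

omit [Finite ι] in
/-- Shrunk supports are closed. [folklore] -/
theorem isClosed_shrunkSet (hZc : ∀ i, IsClosed (Z i)) (i : ι) (t : ℝ) :
    IsClosed (shrunkSet Z p i t) :=
  (hZc i).preimage (by fun_prop)

omit [Finite ι] in
/-- For `0 < t < 1` the shrunk support lies in the interior of the convex cell (`pᵢ` interior).
[folklore] -/
theorem shrunkSet_subset_interior (hZconv : ∀ i, Convex ℝ (Z i)) (hp : ∀ i, p i ∈ interior (Z i))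
    (i : ι) {t : ℝ} (ht0 : 0 < t) (ht1 : t < 1) : shrunkSet Z p i t ⊆ interior (Z i) := by
  intro y hy
  have h : y = (1 - t) • p i + t • (p i + t⁻¹ • (y - p i)) := by
    rw [smul_add, smul_smul, mul_inv_cancel₀ ht0.ne', one_smul, sub_smul, one_smul]; abel
  rw [h]
  exact (hZconv i).combo_interior_self_mem_interior (hp i) hy (by linarith) ht0.le (by ring)

omit [Finite ι] in
/-- **Pieces vanishing off the interiors of convex cells with pairwise disjoint interiors agree
on overlaps**: a common point of `Zᵢ` and `Zⱼ` (`i ≠ j`) lies in neither interior, because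
`Zⱼ ⊆ closure (interior Zⱼ)` (`Convex.closure_interior_eq_closure_of_nonempty_interior`).
[folklore] -/
theorem agree_of_disjoint_interior (hZconv : ∀ i, Convex ℝ (Z i)) (hp : ∀ i, p i ∈ interior (Z i))
    (hdisj : Pairwise fun i j => Disjoint (interior (Z i)) (interior (Z j)))
    (hoff : ∀ i y, y ∉ interior (Z i) → ψ i y = x₀) (i j : ι) (y : Fin k → ℝ) (hi : y ∈ Z i)
    (hj : y ∈ Z j) : ψ i y = ψ j y := by
  by_cases hij : i = j
  · subst hij; rfl
  · -- `y` lies in neither interior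
    have key : ∀ {a b : ι}, a ≠ b → y ∈ Z b → y ∉ interior (Z a) := by
      intro a b hab hb hya
      have hcl : y ∈ closure (interior (Z b)) := by
        rw [(hZconv b).closure_interior_eq_closure_of_nonempty_interior ⟨p b, hp b⟩]
        exact subset_closure hb
      obtain ⟨z, hza, hzb⟩ := mem_closure_iff.1 hcl _ isOpen_interior hya
      exact Set.disjoint_left.1 (hdisj hab) hza hzb
    rw [hoff i y (key hij hj), hoff j y (key (Ne.symm hij) hi)]

omit [Finite ι] in
/-- The pieces shrunk by a common factor `t ∈ (0, 1]` agree on overlaps of their supports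
(for `t < 1` the supports are disjoint; for `t = 1`, `agree_of_disjoint_interior`). [folklore] -/
theorem shrink_agree (hZconv : ∀ i, Convex ℝ (Z i)) (hp : ∀ i, p i ∈ interior (Z i))
    (hdisj : Pairwise fun i j => Disjoint (interior (Z i)) (interior (Z j)))
    (hoff : ∀ i y, y ∉ interior (Z i) → ψ i y = x₀) {t : ℝ} (ht0 : 0 < t) (ht1 : t ≤ 1)
    (i j : ι) (y : Fin k → ℝ) (hi : y ∈ shrunkSet Z p i t) (hj : y ∈ shrunkSet Z p j t) :
    homothety (ψ i) (p i) t ht0 y = homothety (ψ j) (p j) t ht0 y := by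
  rcases ht1.lt_or_eq with ht1 | rfl
  · by_cases hij : i = j
    · subst hij; rfl
    · exact (Set.disjoint_left.1 (hdisj hij) (shrunkSet_subset_interior hZconv hp i ht0 ht1 hi)
        (shrunkSet_subset_interior hZconv hp j ht0 ht1 hj)).elim
  · simp only [homothety_apply, inv_one, one_smul, add_sub_cancel]
    simp only [shrunkSet, mem_setOf_eq, inv_one, one_smul, add_sub_cancel] at hi hj
    exact agree_of_disjoint_interior hZconv hp hdisj hoff i j y hi hj

omit [Finite ι] in
/-- A shrunk piece is `x₀` off the interior of its shrunk support. [folklore] -/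
theorem shrink_off (hoff : ∀ i y, y ∉ interior (Z i) → ψ i y = x₀) {t : ℝ} (ht0 : 0 < t) (i : ι)
    (y : Fin k → ℝ) (hy : y ∉ interior (shrunkSet Z p i t)) : homothety (ψ i) (p i) t ht0 y = x₀ := by
  rw [homothety_apply]
  apply hoff
  intro h
  apply hy
  have hopen : IsOpen {y : Fin k → ℝ | p i + t⁻¹ • (y - p i) ∈ interior (Z i)} :=
    isOpen_interior.preimage (by fun_prop)
  have hsub : {y : Fin k → ℝ | p i + t⁻¹ • (y - p i) ∈ interior (Z i)} ⊆ shrunkSet Z p i t :=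
    fun z hz => (interior_subset (s := Z i) hz : _)
  exact interior_maximal hsub hopen h

variable (ψ Z p) in
/-- **The glued shrunk sphere** at factor `t ∈ (0, 1]`: the pieces `ψᵢ` shrunk by `t` about `pᵢ`,
glued along their shrunk supports. [folklore] -/
def shrinkAt (hZc : ∀ i, IsClosed (Z i)) (hZconv : ∀ i, Convex ℝ (Z i))
    (hp : ∀ i, p i ∈ interior (Z i))
    (hdisj : Pairwise fun i j => Disjoint (interior (Z i)) (interior (Z j)))
    (hoff : ∀ i y, y ∉ interior (Z i) → ψ i y = x₀) (t : ℝ) (ht0 : 0 < t) (ht1 : t ≤ 1) :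
    CSphere k X x₀ :=
  glue (fun i => homothety (ψ i) (p i) t ht0) (fun i => shrunkSet Z p i t)
    (fun i => isClosed_shrunkSet hZc i t) (shrink_agree hZconv hp hdisj hoff ht0 ht1)
    (shrink_off hoff ht0)

variable {hZc : ∀ i, IsClosed (Z i)} {hZconv : ∀ i, Convex ℝ (Z i)} {hp : ∀ i, p i ∈ interior (Z i)}
  {hdisj : Pairwise fun i j => Disjoint (interior (Z i)) (interior (Z j))}
  {hoff : ∀ i y, y ∉ interior (Z i) → ψ i y = x₀}

/-- On the shrunk support of the piece `i`, the glued shrunk sphere is that shrunk piece.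
[folklore] -/
theorem shrinkAt_apply_of_mem {t : ℝ} {ht0 : 0 < t} {ht1 : t ≤ 1} {i : ι} {y : Fin k → ℝ}
    (hy : y ∈ shrunkSet Z p i t) :
    shrinkAt ψ Z p hZc hZconv hp hdisj hoff t ht0 ht1 y = ψ i (p i + t⁻¹ • (y - p i)) :=
  glue_apply_of_mem (i := i) hy

/-- Off all shrunk supports, the glued shrunk sphere is `x₀`. [folklore] -/
theorem shrinkAt_apply_of_forall_not_mem {t : ℝ} {ht0 : 0 < t} {ht1 : t ≤ 1} {y : Fin k → ℝ}
    (hy : ∀ i, y ∉ shrunkSet Z p i t) :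
    shrinkAt ψ Z p hZc hZconv hp hdisj hoff t ht0 ht1 y = x₀ :=
  glue_apply_of_forall_not_mem hy

/-- At `t = 1` the glued shrunk sphere is the superposition of the pieces. [folklore] -/
theorem shrinkAt_one_apply {ht0 : (0 : ℝ) < 1} {ht1 : (1 : ℝ) ≤ 1} (y : Fin k → ℝ) :
    shrinkAt ψ Z p hZc hZconv hp hdisj hoff 1 ht0 ht1 y =
      glueFun x₀ (fun i => ⇑(ψ i)) Z y := by
  by_cases h : ∃ i, y ∈ Z i
  · obtain ⟨i, hi⟩ := h
    rw [glueFun_eq_of_mem (agree_of_disjoint_interior hZconv hp hdisj hoff) hi,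
      shrinkAt_apply_of_mem (i := i)]
    · simp
    · simpa [shrunkSet] using hi
  · rw [glueFun_eq_of_forall_not_mem fun i hi => h ⟨i, hi⟩, shrinkAt_apply_of_forall_not_mem]
    intro i hi
    exact h ⟨i, by simpa [shrunkSet] using hi⟩

/-- The glued shrunk sphere depends only on the factor. [folklore] -/
theorem shrinkAt_congr {t t' : ℝ} {ht0 : 0 < t} {ht1 : t ≤ 1} {ht0' : 0 < t'} {ht1' : t' ≤ 1}
    (h : t = t') : shrinkAt ψ Z p hZc hZconv hp hdisj hoff t ht0 ht1 =
      shrinkAt ψ Z p hZc hZconv hp hdisj hoff t' ht0' ht1' := by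
  subst h; rfl

/-- **Shrinking is a homotopy**: the glued shrunk spheres at factors `1` and `t₀ ∈ (0, 1]` are
homotopic (the family `t ↦ shrinkAt … t`, jointly continuous by the pasting lemma on
`ℝᵏ × ℝ`, with the common bound of the unshrunk pieces). [folklore] -/
theorem homotopic_shrinkAt {t₀ : ℝ} (ht₀ : 0 < t₀) (ht₀1 : t₀ ≤ 1) :
    Homotopic (shrinkAt ψ Z p hZc hZconv hp hdisj hoff 1 one_pos le_rfl)
      (shrinkAt ψ Z p hZc hZconv hp hdisj hoff t₀ ht₀ ht₀1) := by
  -- the factor as a function of the homotopy parameter, clamped: `r s = 1 - s (1 - t₀) ∈ [t₀, 1]`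
  set r : ℝ → ℝ := fun s => 1 - ((projIcc 0 1 zero_le_one s : I) : ℝ) * (1 - t₀) with hrdef
  have hr : ∀ s, t₀ ≤ r s ∧ r s ≤ 1 := fun s => by
    have hs := (projIcc 0 1 zero_le_one s).2
    constructor <;> simp only [hrdef] <;> nlinarith [hs.1, hs.2]
  have hr0 : ∀ s, 0 < r s := fun s => ht₀.trans_le (hr s).1
  have hrc : Continuous r := by rw [hrdef]; fun_prop
  -- joint continuity by the pasting lemma on `ℝᵏ × ℝ`
  let Ψ : ι → (Fin k → ℝ) × ℝ → X := fun i q => ψ i (p i + (r q.2)⁻¹ • (q.1 - p i))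
  let C : ι → Set ((Fin k → ℝ) × ℝ) := fun i => {q | p i + (r q.2)⁻¹ • (q.1 - p i) ∈ Z i}
  have hA : ∀ i, Continuous fun q : (Fin k → ℝ) × ℝ => p i + (r q.2)⁻¹ • (q.1 - p i) := fun i =>
    continuous_const.add (((hrc.comp continuous_snd).inv₀ fun q => (hr0 q.2).ne').smul
      (continuous_fst.sub continuous_const))
  have hΨ : ∀ i, Continuous (Ψ i) := fun i => (ψ i).continuous.comp (hA i)
  have hCc : ∀ i, IsClosed (C i) := fun i => (hZc i).preimage (hA i)
  have hagree' : ∀ i j q, q ∈ C i → q ∈ C j → Ψ i q = Ψ j q := fun i j q hi hj =>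
    shrink_agree hZconv hp hdisj hoff (hr0 q.2) (hr q.2).2 i j q.1 hi hj
  have hoff' : ∀ i q, q ∉ interior (C i) → Ψ i q = x₀ := by
    intro i q hq
    apply hoff
    intro h
    apply hq
    have hopen : IsOpen {q : (Fin k → ℝ) × ℝ | p i + (r q.2)⁻¹ • (q.1 - p i) ∈ interior (Z i)} :=
      isOpen_interior.preimage (hA i)
    have hsub : {q : (Fin k → ℝ) × ℝ | p i + (r q.2)⁻¹ • (q.1 - p i) ∈ interior (Z i)} ⊆ C i :=
      fun z hz => (interior_subset (s := Z i) hz : _)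
    exact interior_maximal hsub hopen h
  have hcont := continuous_glueFun hΨ hCc hagree' hoff'
  -- the family of spheres and its identification with the glued map on `ℝᵏ × ℝ`
  let Φ : ℝ → CSphere k X x₀ := fun s =>
    shrinkAt ψ Z p hZc hZconv hp hdisj hoff (r s) (hr0 s) (hr s).2
  have hΦ : ∀ s y, Φ s y = glueFun x₀ Ψ C (y, s) := by
    intro s y
    by_cases h : ∃ i, (y, s) ∈ C i
    · obtain ⟨i, hi⟩ := h
      rw [glueFun_eq_of_mem hagree' hi]
      exact shrinkAt_apply_of_mem (i := i) hi
    · rw [glueFun_eq_of_forall_not_mem fun i hi => h ⟨i, hi⟩]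
      exact shrinkAt_apply_of_forall_not_mem fun i hi => h ⟨i, hi⟩
  have hΦ0 : Φ 0 = shrinkAt ψ Z p hZc hZconv hp hdisj hoff 1 one_pos le_rfl :=
    shrinkAt_congr (by simp [hrdef])
  have hΦ1 : Φ 1 = shrinkAt ψ Z p hZc hZconv hp hdisj hoff t₀ ht₀ ht₀1 :=
    shrinkAt_congr (by simp [hrdef])
  rw [← hΦ0, ← hΦ1]
  -- a common bound: the pieces at factor `≤ 1`
  choose R hR0 hR using fun i => (ψ i).exists_bound_nonneg
  obtain ⟨R₀, hR₀⟩ := (Set.finite_range fun i => (R i + ‖p i‖) + ‖p i‖).bddAbove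
  refine homotopic_of_family Φ ?_ R₀ fun s _ y hy => ?_
  · exact (hcont.comp (continuous_fst.prodMk continuous_snd)).congr fun q => (hΦ q.2 q.1).symm
  · by_cases h : ∃ i, y ∈ shrunkSet Z p i (r s)
    · obtain ⟨i, hi⟩ := h
      rw [shrinkAt_apply_of_mem (i := i) hi]
      refine hR i _ (le_norm_homothetyInv_of_le (hr0 s) (hr s).2 (hR0 i) ?_)
      rw [one_mul]
      exact (hR₀ ⟨i, rfl⟩).trans hy
    · exact shrinkAt_apply_of_forall_not_mem fun i hi => h ⟨i, hi⟩

end Shrink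

end CSphere

end Literature.AlgebraicTopology.Homotopy

end
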